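import Literature.AlgebraicGeometry.Resolution.MarkedIdealsLemmas
import HarnessLib

/-!
# Stalks of ideal sheaves: intersections, radicals, inverse images; products of non-associated primes

Topic: `Literature/AlgebraicGeometry/Resolution`. Bookkeeping for the stalk `I_x ⊆ 𝒪_{X,x}` of an
ideal sheaf (`stalkIdeal`, `MarkedIdeals.lean`), complementing `stalkIdeal_mul`, `stalkIdeal_pow`,
`stalkIdeal_sup` (`MarkedIdealsLemmas.lean`, `MarkedIdealsArithmetic.lean`) and the affine case
`stalkIdeal_comap` (`StrictNormalCrossingsFlatDescent.lean`):

* `stalkIdeal_inf`, `stalkIdeal_finset_inf` — stalks commute with finite intersections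
  (localization commutes with finite intersections of ideals: Mathlib's `IsLocalization.map_inf`);
* `stalkIdeal_radical` — `(√I)_x = √(I_x)`;
* `stalkIdeal_comap_eq_map_stalkMap` — for ANY morphism `f : X → Y`, `(f⁻¹K · 𝒪_X)_x = K_{f x} · 𝒪_{X,x}`
  (chart formula `ideal_comap_of_le` on affine opens `V ⊆ f⁻¹U`);
* `vanishingIdeal_preimage` — the ideal of the reduced structure on `f⁻¹(Z)` is the radical of
  `f⁻¹ I_Z · 𝒪_X`;
* `Finset.prod_dvd_of_forall_dvd_of_pairwise`, `Ideal.radical_span_singleton_prod_eq`,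
  `Ideal.span_singleton_inf_span_singleton_prod` — products of pairwise non-associated prime
  elements: they divide every common multiple, generate radical ideals, and intersect as
  expected (used with regular systems of parameters, whose members are pairwise non-associated
  primes, `prime_of_rsop`, `not_dvd_of_rsop`).

All statements are [folklore] commutative algebra / scheme bookkeeping.
-/

noncomputable section

open CategoryTheory AlgebraicGeometry TopologicalSpace IsLocalRing

namespace Literature.AlgebraicGeometry.Resolution

universe u

open Scheme.IdealSheafData

/-! ## Finite intersections -/

variable {X Y : Scheme.{u}}

/-- **Stalks commute with intersections**: `(I ∩ J)_x = I_x ∩ J_x`. [folklore] -/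
theorem stalkIdeal_inf (I J : X.IdealSheafData) (x : X) :
    stalkIdeal (I ⊓ J) x = stalkIdeal I x ⊓ stalkIdeal J x := by
  obtain ⟨U, hU, hxU, -⟩ :=
    exists_isAffineOpen_mem_and_subset (X := X) (x := x) (U := ⊤) (Opens.mem_top x)
  letI := TopCat.Presheaf.algebra_section_stalk X.presheaf (⟨x, hxU⟩ : (U : X.Opens))
  haveI := hU.isLocalization_stalk ⟨x, hxU⟩
  rw [stalkIdeal_eq_map_germ _ ⟨U, hU⟩ hxU, stalkIdeal_eq_map_germ _ ⟨U, hU⟩ hxU,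
    stalkIdeal_eq_map_germ _ ⟨U, hU⟩ hxU, ideal_inf, Pi.inf_apply]
  exact IsLocalization.map_inf (hU.primeIdealOf ⟨x, hxU⟩).asIdeal.primeCompl
    (X.presheaf.stalk x) _ _

/-- Stalks commute with finite intersections. [folklore] -/
theorem stalkIdeal_finset_inf {ι : Type*} (s : Finset ι) (I : ι → X.IdealSheafData) (x : X) :
    stalkIdeal (s.inf I) x = s.inf fun i => stalkIdeal (I i) x := by
  classical
  induction s using Finset.induction_on with
  | empty => rw [Finset.inf_empty, Finset.inf_empty, stalkIdeal_top]
  | insert a s ha ih => rw [Finset.inf_insert, Finset.inf_insert, stalkIdeal_inf, ih]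

/-! ## Radicals -/

/-- **Stalks commute with radicals**: `(√I)_x = √(I_x)` (localization commutes with radicals).
[folklore] -/
theorem stalkIdeal_radical (I : X.IdealSheafData) (x : X) :
    stalkIdeal I.radical x = (stalkIdeal I x).radical := by
  obtain ⟨U, hU, hxU, -⟩ :=
    exists_isAffineOpen_mem_and_subset (X := X) (x := x) (U := ⊤) (Opens.mem_top x)
  letI := TopCat.Presheaf.algebra_section_stalk X.presheaf (⟨x, hxU⟩ : (U : X.Opens))
  haveI := hU.isLocalization_stalk ⟨x, hxU⟩
  rw [stalkIdeal_eq_map_germ _ ⟨U, hU⟩ hxU, stalkIdeal_eq_map_germ _ ⟨U, hU⟩ hxU, radical_ideal]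
  exact IsLocalization.map_radical (hU.primeIdealOf ⟨x, hxU⟩).asIdeal.primeCompl
    (X.presheaf.stalk x) (I.ideal ⟨U, hU⟩)

/-! ## Inverse images -/

/-- **The stalk of an inverse image ideal sheaf**: for a morphism `f : X → Y`, an ideal sheaf `K`
on `Y` and `x ∈ X`, `(f⁻¹K · 𝒪_X)_x = K_{f x} · 𝒪_{X,x}` (extension along `f_x^# : 𝒪_{Y,f x} → 𝒪_{X,x}`):
on affine opens `V ∋ x`, `U ∋ f x` with `f(V) ⊆ U`, `(f⁻¹K 𝒪_X)(V) = K(U) Γ(X, V)`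
(`ideal_comap_of_le`) and `germ_V ∘ f^*_{U,V} = f_x^# ∘ germ_U`. [folklore] -/
theorem stalkIdeal_comap_eq_map_stalkMap (f : X ⟶ Y) (K : Y.IdealSheafData) (x : X) :
    stalkIdeal (K.comap f) x = (stalkIdeal K (f x)).map (f.stalkMap x).hom := by
  obtain ⟨U, hU, hfxU, -⟩ :=
    exists_isAffineOpen_mem_and_subset (X := Y) (x := f x) (U := ⊤) (Opens.mem_top _)
  obtain ⟨V, hV, hxV, hVU⟩ :=
    exists_isAffineOpen_mem_and_subset (X := X) (x := x) (U := f ⁻¹ᵁ U) hfxU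
  rw [stalkIdeal_eq_map_germ _ ⟨V, hV⟩ hxV, stalkIdeal_eq_map_germ _ ⟨U, hU⟩ hfxU,
    ideal_comap_of_le f K ⟨U, hU⟩ ⟨V, hV⟩ hVU, Ideal.map_map, Ideal.map_map]
  congr 1
  rw [← CommRingCat.hom_comp, ← CommRingCat.hom_comp]
  congr 1
  rw [Scheme.Hom.germ_stalkMap, Scheme.Hom.appLE, Category.assoc, X.presheaf.germ_res]

/-- **The ideal of a preimage**: for `Z ⊆ Y` closed, the vanishing ideal sheaf of the closed
subset `f⁻¹(Z) ⊆ X` (its reduced structure) is the radical of the inverse image `f⁻¹ I_Z · 𝒪_X`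
of the vanishing ideal sheaf of `Z` — both have support `f⁻¹(Z)`. [folklore] -/
theorem vanishingIdeal_preimage (f : X ⟶ Y) (Z : Closeds Y) :
    vanishingIdeal (Z.preimage f.continuous) = ((vanishingIdeal Z).comap f).radical := by
  rw [← vanishingIdeal_support (I := (vanishingIdeal Z).comap f), support_comap]
  congr 1

/-- The stalk form: `I(f⁻¹Z)_x = √(I(Z)_{f x} · 𝒪_{X,x})`. [folklore] -/
theorem stalkIdeal_vanishingIdeal_preimage (f : X ⟶ Y) (Z : Closeds Y) (x : X) :
    stalkIdeal (vanishingIdeal (Z.preimage f.continuous)) x =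
      ((stalkIdeal (vanishingIdeal Z) (f x)).map (f.stalkMap x).hom).radical := by
  rw [vanishingIdeal_preimage, stalkIdeal_radical, stalkIdeal_comap_eq_map_stalkMap]

/-! ## Products of pairwise non-associated primes -/

section Primes

variable {R : Type*} [CommRing R] [IsDomain R] {ι : Type*} (q : ι → R)

omit [IsDomain R] in
/-- **A product of pairwise non-associated primes divides every common multiple.** [folklore] -/
theorem Finset.prod_dvd_of_forall_dvd_of_pairwise (s : Finset ι) (hq : ∀ i ∈ s, Prime (q i))
    (hna : ∀ i ∈ s, ∀ j ∈ s, i ≠ j → ¬ q i ∣ q j) {x : R} (hx : ∀ i ∈ s, q i ∣ x) :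
    (∏ i ∈ s, q i) ∣ x := by
  classical
  induction s using Finset.induction_on generalizing x with
  | empty => exact ⟨x, by rw [Finset.prod_empty, one_mul]⟩
  | insert a s ha ih =>
    have hs : ∀ i ∈ s, Prime (q i) := fun i hi => hq i (Finset.mem_insert_of_mem hi)
    have hna' : ∀ i ∈ s, ∀ j ∈ s, i ≠ j → ¬ q i ∣ q j := fun i hi j hj =>
      hna i (Finset.mem_insert_of_mem hi) j (Finset.mem_insert_of_mem hj)
    obtain ⟨y, rfl⟩ := ih hs hna' fun i hi => hx i (Finset.mem_insert_of_mem hi)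
    have hqa : Prime (q a) := hq a (Finset.mem_insert_self a s)
    rcases hqa.dvd_or_dvd (hx a (Finset.mem_insert_self a s)) with h | h
    · -- `q a` divides the product of the others: impossible
      obtain ⟨i, hi, hdiv⟩ := hqa.exists_mem_finset_dvd h
      exact absurd hdiv (hna a (Finset.mem_insert_self a s) i (Finset.mem_insert_of_mem hi)
        (fun h => ha (h ▸ hi)))
    · obtain ⟨w, rfl⟩ := h
      rw [Finset.prod_insert ha]
      exact ⟨w, by ring⟩

omit [IsDomain R] in
/-- **A product of pairwise non-associated primes generates a radical ideal.** [folklore] -/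
theorem Ideal.radical_span_singleton_prod_eq (s : Finset ι) (hq : ∀ i ∈ s, Prime (q i))
    (hna : ∀ i ∈ s, ∀ j ∈ s, i ≠ j → ¬ q i ∣ q j) :
    (Ideal.span {∏ i ∈ s, q i}).radical = Ideal.span {∏ i ∈ s, q i} := by
  refine le_antisymm ?_ Ideal.le_radical
  rintro x ⟨n, hn⟩
  rw [Ideal.mem_span_singleton] at hn ⊢
  refine Finset.prod_dvd_of_forall_dvd_of_pairwise q s hq hna fun i hi => ?_
  exact (hq i hi).dvd_of_dvd_pow ((Finset.dvd_prod_of_mem q hi).trans hn)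

/-- **Intersecting with one more non-associated prime**: for a prime `p` not dividing, nor
divisible by, the pairwise non-associated primes `qᵢ`, `(p) ∩ (∏ qᵢ) = (p · ∏ qᵢ)`. [folklore] -/
theorem Ideal.span_singleton_inf_span_singleton_prod (s : Finset ι) (hq : ∀ i ∈ s, Prime (q i))
    (hna : ∀ i ∈ s, ∀ j ∈ s, i ≠ j → ¬ q i ∣ q j) {p : R} (hp : Prime p)
    (hpq : ∀ i ∈ s, ¬ p ∣ q i) :
    Ideal.span {p} ⊓ Ideal.span {∏ i ∈ s, q i} = Ideal.span {p * ∏ i ∈ s, q i} := by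
  classical
  apply le_antisymm
  · rintro x ⟨hxp, hxq⟩
    rw [SetLike.mem_coe, Ideal.mem_span_singleton] at hxp hxq
    rw [Ideal.mem_span_singleton]
    -- the product of the `qᵢ` divides `x = p y`, hence `y`
    obtain ⟨y, rfl⟩ := hxp
    have hy : (∏ i ∈ s, q i) ∣ y := by
      refine Finset.prod_dvd_of_forall_dvd_of_pairwise q s hq hna fun i hi => ?_
      have h := (Finset.dvd_prod_of_mem q hi).trans hxq
      rcases (hq i hi).dvd_or_dvd h with h' | h'
      · -- `qᵢ ∣ p`: then `p ∣ qᵢ` (both prime), excluded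
        exact absurd ((hq i hi).irreducible.dvd_symm hp.irreducible h') (hpq i hi)
      · exact h'
    exact mul_dvd_mul_left p hy
  · rw [le_inf_iff, Ideal.span_singleton_le_span_singleton, Ideal.span_singleton_le_span_singleton]
    exact ⟨dvd_mul_right _ _, dvd_mul_left _ _⟩

end Primes

end Literature.AlgebraicGeometry.Resolution

end
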